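import Mathlib
import HarnessLib
import Summits.HubbardSuperconductivity.HubbardSuperconductivity.Theorems.WeakCouplingBCSWcbcsBcsConstructionThinSufficiency

/-!
# Crux `WcbcsSsbToTorusLRO` (stmt-HubbardSuperconductivity-2009): ROBUST ⊕ THIN glue — the summit from the
# ROBUST transfer (order on a NEIGHBOURHOOD of `μ`) and thin `d`-wave order on a `μ`-sub-interval

Lead c4 of line `off-zero-mode-moment-closure` (prover-line-stmt-HubbardSuperconductivity-2009-c4-0), 2026-08-17.
Write `n_L(U,μ) = Re ω₀[hubbardTorusWith 2 (L+1) 1 U μ](N)/(L+1)²` (tracial grand-canonical ground-state density) and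
`DM U δ μ :≡ n_L(U,μ) → 1 - δ` (density matching).

WHY.  The typed crux 2 quantifies `∀ δ ∈ (0,1/2) ∀ μ` at FIXED small `U` and asks for `d_{x²-y²}` pair-field LRO of every
canonical sector ground state from `DM U δ μ` and order AT THE POINT `μ` (`HasDWaveOrder U μ`).  The crux's standing disproof
(`Cruxes/WcbcsSsbToTorusLRO/Disproof.lean` §4–§5) isolates the one scenario in which this is expected to FAIL inside the
Hubbard family at every `U > 0`: a first-order ENDPOINT `μ_c(U)` (candidate at `t' = 0`: the SDW/d-SC boundary at `δ_AF(U) → 0⁺`),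
where the source selects the ordered phase (`HasDWaveOrder U μ_c`) while the source-free tori sit in the competing phase
(`DM` at the endpoint density, no B1g LRO).  Requiring order on a NEIGHBOURHOOD of `μ` (`∀ᶠ μ' in 𝓝 μ, HasDWaveOrder U μ'`, the
disproof's `OrderNearby`) removes exactly that endpoint, and is a WEAKER transfer (`robustTransfer_of_wcbcsSsbToTorusLRO`).
On the other side, the sibling crux 4 (stmt-2010) has been reduced by its lead (p144261, `…ThinSufficiency.lean`) to THIN ORDER —
`∀ U₁ > 0 ∃ U ∈ (0,U₁) ∃ -21/25 ≤ a < b ≤ -7/20 ∀ μ ∈ (a,b), HasDWaveOrder U μ` — with density matching for free (a.e. `μ`,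
Griffiths + certified free level counts, p142962/p142920/p143400).  Thin order hands over order on an OPEN interval, i.e. exactly
the robust hypothesis.  Hence the two recommended restatements are CONSISTENT and jointly sufficient:

* `hubbardSuperconductivity_of_windowedRobustTransfer_of_thinOrder` — the WEAKEST transfer of the menu (robust hypothesis, and
  only for `μ` in the window `[-21/25, -7/20]`) + thin order ⇒ `HubbardSuperconductivity`;
* `hubbardSuperconductivity_of_robustTransfer_of_thinOrder` — robust transfer (all `μ`) + thin order ⇒ summit;
* `robustTransfer_of_wcbcsSsbToTorusLRO`, `windowedRobustTransfer_of_robustTransfer` — crux 2 ⇒ robust ⇒ windowed robust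
  (so both are weakenings of the typed crux; composing `robustTransfer_of_wcbcsSsbToTorusLRO` with
  `hubbardSuperconductivity_of_robustTransfer_of_thinOrder` recovers p144261's landed `hubbardSuperconductivity_of_wcbcsSsbToTorusLRO_of_thinOrder`,
  which is therefore not restated here).

All sorry-free, standard axioms; pure logic over landed theorems.  Nothing here proves the transfer or the order: the open content
of the route is unchanged (every-GS phase stiffness T / neutral response N / charging floor C on the transfer side — reduction p91563,
pointwise p141333 — and `d`-wave symmetry breaking on some `μ`-interval at arbitrarily weak repulsion on the construction side).
References: T. Koma, H. Tasaki, J. Stat. Phys. 76 (1994) 745, §1; C. Borgs, R. Kotecký, J. Stat. Phys. 61 (1990) 79 (torus states at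
a first-order point are decided by sub-extensive corrections — the endpoint mechanism); R. B. Griffiths, J. Math. Phys. 5 (1964) 1215.
-/

noncomputable section

-- the tree's namespace `Summit.<Summit>.<Problem>.Theorems` repeats the summit name by design (D-0017)
set_option linter.dupNamespace false

namespace Summit.HubbardSuperconductivity.HubbardSuperconductivity.Theorems

open Literature.MathematicalPhysics.QuantumLattice Literature.Probability.LatticeModels Filter
open Summit.HubbardSuperconductivity.HubbardSuperconductivity.Theses.WeakCouplingBCS
open scoped Topology

/-- **Crux 2 implies the ROBUST transfer** (order on a neighbourhood of `μ` is more than order at `μ`: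
`Filter.Eventually.self_of_nhds`), so the robust transfer is a weakening of `WcbcsSsbToTorusLRO`. [cite: KomaTasaki1994, §1] -/
theorem robustTransfer_of_wcbcsSsbToTorusLRO (h2 : WcbcsSsbToTorusLRO) :
    ∃ U₀ : ℝ, 0 < U₀ ∧ ∀ U ∈ Set.Ioo (0:ℝ) U₀, ∀ δ ∈ Set.Ioo (0:ℝ) (1 / 2), ∀ μ : ℝ,
      Tendsto (fun L : ℕ => ((hubbardTorusWith 2 (L + 1) 1 U μ).groundStateFunctional
        totalNumber).re / ((L + 1 : ℕ) : ℝ) ^ 2) atTop (𝓝 (1 - δ)) →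
      (∀ᶠ μ' in 𝓝 μ, HasDWaveOrder U μ') → Literature.Barriers.HubbardSuperconductivity.HasDWavePairFieldLROAt U δ := by
  obtain ⟨U₀, hU₀, h⟩ := h2
  exact ⟨U₀, hU₀, fun U hU δ hδ μ hdm hnb => h U hU δ hδ μ hdm hnb.self_of_nhds⟩

/-- **The robust transfer implies the WINDOWED robust transfer** (restricting `μ` to the window `[-21/25, -7/20]` only weakens).
[cite: KomaTasaki1994, §1] -/
theorem windowedRobustTransfer_of_robustTransfer
    (h2r : ∃ U₀ : ℝ, 0 < U₀ ∧ ∀ U ∈ Set.Ioo (0:ℝ) U₀, ∀ δ ∈ Set.Ioo (0:ℝ) (1 / 2), ∀ μ : ℝ,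
      Tendsto (fun L : ℕ => ((hubbardTorusWith 2 (L + 1) 1 U μ).groundStateFunctional
        totalNumber).re / ((L + 1 : ℕ) : ℝ) ^ 2) atTop (𝓝 (1 - δ)) →
      (∀ᶠ μ' in 𝓝 μ, HasDWaveOrder U μ') → Literature.Barriers.HubbardSuperconductivity.HasDWavePairFieldLROAt U δ) :
    ∃ U₀ : ℝ, 0 < U₀ ∧ ∀ U ∈ Set.Ioo (0:ℝ) U₀, ∀ δ ∈ Set.Ioo (0:ℝ) (1 / 2),
      ∀ μ ∈ Set.Icc (-(21:ℝ) / 25) (-(7:ℝ) / 20),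
      Tendsto (fun L : ℕ => ((hubbardTorusWith 2 (L + 1) 1 U μ).groundStateFunctional
        totalNumber).re / ((L + 1 : ℕ) : ℝ) ^ 2) atTop (𝓝 (1 - δ)) →
      (∀ᶠ μ' in 𝓝 μ, HasDWaveOrder U μ') → Literature.Barriers.HubbardSuperconductivity.HasDWavePairFieldLROAt U δ := by
  obtain ⟨U₀, hU₀, h⟩ := h2r
  exact ⟨U₀, hU₀, fun U hU δ hδ μ _ hdm hnb => h U hU δ hδ μ hdm hnb⟩

/-- **ROBUST ⊕ THIN SUFFICIENCY (weakest form).** The WINDOWED ROBUST transfer — for all small `U`, all `δ ∈ (0,1/2)` and all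
`μ ∈ [-21/25, -7/20]`: density matching at `(δ, μ)` and `d`-wave order on a NEIGHBOURHOOD of `μ` give `HasDWavePairFieldLROAt U δ` —
together with THIN ORDER (`∀ U₁ > 0 ∃ U ∈ (0,U₁) ∃ -21/25 ≤ a < b ≤ -7/20 ∀ μ ∈ (a,b), HasDWaveOrder U μ`) imply the summit
`HubbardSuperconductivity`.  Proof: (T3) `stub_aeDensityMatching` (fed by (T2), (T1)) gives `U₃ > 0` such that for `U ≤ U₃` every open
sub-interval `(a,b)` of the window contains a density-matched `μ` with `δ ∈ (0,1/2)`; take thin order below `min U₀ U₃`; the open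
interval `(a,b) ∋ μ` is a neighbourhood of `μ` on which the order holds; apply the transfer. [cite: KomaTasaki1994, §1] -/
theorem hubbardSuperconductivity_of_windowedRobustTransfer_of_thinOrder
    (h2w : ∃ U₀ : ℝ, 0 < U₀ ∧ ∀ U ∈ Set.Ioo (0:ℝ) U₀, ∀ δ ∈ Set.Ioo (0:ℝ) (1 / 2),
      ∀ μ ∈ Set.Icc (-(21:ℝ) / 25) (-(7:ℝ) / 20),
      Tendsto (fun L : ℕ => ((hubbardTorusWith 2 (L + 1) 1 U μ).groundStateFunctional
        totalNumber).re / ((L + 1 : ℕ) : ℝ) ^ 2) atTop (𝓝 (1 - δ)) →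
      (∀ᶠ μ' in 𝓝 μ, HasDWaveOrder U μ') → Literature.Barriers.HubbardSuperconductivity.HasDWavePairFieldLROAt U δ)
    (hthin : ∀ U₁ : ℝ, 0 < U₁ → ∃ U ∈ Set.Ioo (0:ℝ) U₁, ∃ a b : ℝ, -(21:ℝ) / 25 ≤ a ∧ a < b ∧ b ≤ -(7:ℝ) / 20 ∧
      ∀ μ ∈ Set.Ioo a b, HasDWaveOrder U μ) :
    _root_.HubbardSuperconductivity := by
  obtain ⟨U₀, hU₀, h2⟩ := h2w
  obtain ⟨U₃, hU₃, hT3⟩ := stub_aeDensityMatching (stub_densityInsideUnitWindow stub_freeLevelCountsOuter)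
  obtain ⟨U, hU, a, b, ha, hab, hb, hord⟩ := hthin (min U₀ U₃) (lt_min hU₀ hU₃)
  have hUU₀ : U ∈ Set.Ioo (0:ℝ) U₀ := ⟨hU.1, lt_of_lt_of_le hU.2 (min_le_left _ _)⟩
  have hUU₃ : U ∈ Set.Icc (0:ℝ) U₃ := ⟨hU.1.le, (lt_of_lt_of_le hU.2 (min_le_right _ _)).le⟩
  obtain ⟨μ, hμ, δ, hδ, hdens⟩ := hT3 U hUU₃ a b ha hab hb
  have hwin : μ ∈ Set.Icc (-(21:ℝ) / 25) (-(7:ℝ) / 20) := ⟨ha.trans hμ.1.le, hμ.2.le.trans hb⟩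
  have hnb : ∀ᶠ μ' in 𝓝 μ, HasDWaveOrder U μ' :=
    Filter.eventually_of_mem (Ioo_mem_nhds hμ.1 hμ.2) hord
  exact ⟨U, hU.1, δ, hδ, h2 U hUU₀ δ hδ μ hwin hdens hnb⟩

/-- **ROBUST ⊕ THIN SUFFICIENCY.** The ROBUST transfer (all `μ`; hypothesis: density matching and `d`-wave order on a
neighbourhood of `μ`) and THIN ORDER imply `HubbardSuperconductivity`. [cite: KomaTasaki1994, §1] -/
theorem hubbardSuperconductivity_of_robustTransfer_of_thinOrder
    (h2r : ∃ U₀ : ℝ, 0 < U₀ ∧ ∀ U ∈ Set.Ioo (0:ℝ) U₀, ∀ δ ∈ Set.Ioo (0:ℝ) (1 / 2), ∀ μ : ℝ,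
      Tendsto (fun L : ℕ => ((hubbardTorusWith 2 (L + 1) 1 U μ).groundStateFunctional
        totalNumber).re / ((L + 1 : ℕ) : ℝ) ^ 2) atTop (𝓝 (1 - δ)) →
      (∀ᶠ μ' in 𝓝 μ, HasDWaveOrder U μ') → Literature.Barriers.HubbardSuperconductivity.HasDWavePairFieldLROAt U δ)
    (hthin : ∀ U₁ : ℝ, 0 < U₁ → ∃ U ∈ Set.Ioo (0:ℝ) U₁, ∃ a b : ℝ, -(21:ℝ) / 25 ≤ a ∧ a < b ∧ b ≤ -(7:ℝ) / 20 ∧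
      ∀ μ ∈ Set.Ioo a b, HasDWaveOrder U μ) :
    _root_.HubbardSuperconductivity :=
  hubbardSuperconductivity_of_windowedRobustTransfer_of_thinOrder
    (windowedRobustTransfer_of_robustTransfer h2r) hthin

/-- **Registered form (glue stub `stub_summitOfRobustTransferOfThinOrder` of crux stmt-HubbardSuperconductivity-2009):** robust transfer →
thin order → the summit; the robust-hypothesis analogue of the sibling line's `stub_summitOfThinOrder` (p144261). [cite: KomaTasaki1994, §1] -/
theorem stub_summitOfRobustTransferOfThinOrder :
    (∃ U₀ : ℝ, 0 < U₀ ∧ ∀ U ∈ Set.Ioo (0:ℝ) U₀, ∀ δ ∈ Set.Ioo (0:ℝ) (1 / 2), ∀ μ : ℝ, Filter.Tendsto (fun L : ℕ => ((hubbardTorusWith 2 (L + 1) 1 U μ).groundStateFunctional totalNumber).re / ((L + 1 : ℕ) : ℝ) ^ 2) Filter.atTop (nhds (1 - δ)) → (∀ᶠ μ' in nhds μ, HasDWaveOrder U μ') → Literature.Barriers.HubbardSuperconductivity.HasDWavePairFieldLROAt U δ) → (∀ U₁ : ℝ, 0 < U₁ → ∃ U ∈ Set.Ioo (0:ℝ)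 U₁, ∃ a b : ℝ, -(21:ℝ) / 25 ≤ a ∧ a < b ∧ b ≤ -(7:ℝ) / 20 ∧ ∀ μ ∈ Set.Ioo a b, HasDWaveOrder U μ) → _root_.HubbardSuperconductivity :=
  fun h2r hthin => hubbardSuperconductivity_of_robustTransfer_of_thinOrder h2r hthin

end Summit.HubbardSuperconductivity.HubbardSuperconductivity.Theorems

end
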